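/-
Copyright (c) 2026 the pub-hodgecm-mathlib formalisation cell (harness21).  Prover seat hodgecm-mathlib-K2E1-p10 (g0), Track B ∕ K2-LIT, h413 = `stmt-HodgeConjecture-24833`,
line `K2_E1_TraceFormulaBeta`, campaign «EIS-WHITTAKER-3», DEAL D-W4 «W2₃-fin-split» of the dealer K2E1-plan (g5) 2026-09-04T08:09:42Z (DEALS MEMO fe56b7cd5d935977),
FILE A of three: THE SHELL FORMULA for a radial function against an additive character, and the floor integrals of level zero and one.
-/
import Summits.HodgeConjecture.HodgeConjecture.Theorems.K2E1GindikinKarpelevichSplitGL3Haar   -- ★ (K2E3-p12 g5): big-cell algebra §1, `integrable_inner`, `integrable_zySection`, `integrable_bigCellIntegrand`; brings ★ p858040, ★ `K2LiuGKRankOneIntegral`, ★ `LocalFieldHaarBalls`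
import HarnessLib

/-!
# K2·E1 — `K2E1FiniteWhittakerSplitU3Inner` (D-W4 FILE A): radial functions against characters; the floor integrals `G_η(w) = ∫_u max(1,‖w‖,‖u‖)^{−s} ψ(uη) dμ(u)`

Track B ∕ K2-LIT, crux h413 = `stmt-HodgeConjecture-24833`, route of record `HCCMUnconditional`; cell `hodgecm-mathlib`, squad K2, ENGINE E1, campaign «EIS-WHITTAKER-3»
(the Whittaker layer of `E − E_B` on `U(2,1)_{L∕L⁺}` at a place `v = ww̄` of `L⁺` SPLIT in `L`, where `U(J₃)(L⁺_v) ≅ GL₃(F)`, `F = L⁺_v`; CONVENTIONS W0₃ 2fdd2f7063acaab9 §3∕§4 (ii′)).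
THEOREMS ONLY (no `def`, no `instance`, no notation, no named-fact hypothesis, no `sorry`).  FILE B = `K2E1FiniteWhittakerSplitU3Fibre` (inner integral, `x`-fibres), FILE C =
`K2E1FiniteWhittakerSplitU3` (the unit value `μ(𝒪)³(1−q^{−s})²(1−q^{−(2s−1)})`, Haar form, `t`-symbol order, trivial bound, holomorphy on `{1 < Re s}`).

THE OBJECT.  With the big-cell coordinates `n(x,y,z)` of ★ `K2E1GindikinKarpelevichSplitGL3` (`Φ_s(w₀n) = (max(1,‖x‖,‖z‖)·max(1,‖y‖,‖z−xy‖))^{−s}`, complex `s`, the flat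
spherical section `H^s` RAW) and a character `ψ_N(n) = ψ₁(ξ₁x)ψ₂(ξ₂y)` of `N(F)` (`N∕[N,N] ≅ F²`; at `v = ww̄`, `(ψ₁,ψ₂) = (ψ_w, ψ_w̄)` with conductor letters `(m_w, m_w̄)`, frequency
`(ξ_w, ξ_w̄)`), the local Whittaker (Jacquet) integral is `W(ξ;s) = ∫_x (∫_z ∫_y max(1,‖x‖,‖z‖)^{−s} max(1,‖y‖,‖z−xy‖)^{−s} ψ₂(yξ₂) dμ dμ) ψ₁(xξ₁) dμ` (order `x, z, y` of ★, the
`y`-character INNERMOST).  Currency = ★ p858310 `K2E1FiniteWhittakerPolynomial`: `ψ : AddChar F Circle` continuous, `ψ.HasConductorExp m`, `((ψ (t * ξ) : Circle) : ℂ)`, balls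
`𝔭^j = primePowBall F j`, spheres `𝔭^{−(k+1)} ∖ 𝔭^{−k}` (★ `K2LiuGKRankOneIntegral` outer shells), `q = residueFieldCard F`, weights `((max 1 (max ‖a‖ ‖b‖) : ℝ) : ℂ) ^ (-s)`.

THE ONE TOOL (§1, `integral_radial_mul_addChar_eq`, THE SHELL FORMULA [Tate1950 §2.5; Casselman1980 §3]): for `φ : F → ℂ` integrable and RADIAL, `ψ` of conductor exponent `m` and
`ξ ∈ 𝔭^{m+n} ∖ 𝔭^{m+n+1}` (`n : ℕ`):  **`∫_F φ(y)ψ(yξ) dμ = ∫_{𝔭^{−n}} φ dμ − (q−1)⁻¹ · ∫_{𝔭^{−(n+1)} ∖ 𝔭^{−n}} φ dμ`**  (the character is `1` on `𝔭^{−n}`, integrates to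
`−μ(𝔭^{−n})` on the next sphere and to `0` beyond: ★ `setIntegral_primePowBall_addChar_mul` sphere by sphere, ★ `integral_iUnion` over ★ `compl_primePowBall_zero_eq_iUnion`).
Every stage of the D-W4 computation is «radial function × character», so this lemma is used four times (in `y`, `u`, `z'`, `x`) and no Casselman–Shalika∕Shintani machinery is invoked.
* §2 the complex weights (continuity, `‖M^{−s}‖ = M^{−Re s}`, integrability of the floor weight for `Re s > 1` by ★ p858040, measurability∕bound of the floor integral
  `G_η(w) := ∫_u max(1,‖w‖,‖u‖)^{−s} ψ(uη) dμ`, discreteness `z ∉ 𝒪 ⟹ q ≤ ‖z‖`);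
* §3 `G_η(w)` at a frequency of LEVEL ZERO (`η ∈ 𝔭^m ∖ 𝔭^{m+1}`): `μ(𝒪)(max(1,‖w‖)^{−s} − max(q,‖w‖)^{−s})` — `= μ(𝒪)(1 − q^{−s})` for `w ∈ 𝒪`, `= 0` for `w ∉ 𝒪`; and of
  LEVEL ONE (`η ∈ 𝔭^{m+1} ∖ 𝔭^{m+2}`, `‖w‖ ≤ q`): `μ(𝒪)(max(1,‖w‖)^{−s} + (q−1)q^{−s} − q·q^{−2s})`;
(FILE B §4 turns the inner integral `I(x,z) = ∫_y max(1,‖y‖,‖z−xy‖)^{−s}ψ(yξ) dμ` into these floor integrals: at `w = z` for `‖x‖ ≤ 1`, at the DILATED frequency `x⁻¹ξ` for `‖x‖ ≥ 1`.)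
SAT-WITNESS: nothing is quantified over a structure (`F` any non-archimedean local field, `μ` any additive Haar measure, `ψ` any continuous additive character).
HONEST LABEL: HC_CM is proved only modulo the 7 printed citations (2 remaining named inputs: hLiu418 = `stmt-HodgeConjecture-24832`, h413 = `stmt-HodgeConjecture-24833`)
until rung 0 closes; this file asserts no named fact and closes no socket (lane `--supports stmt-HodgeConjecture-24833`, count-neutral).
References: [Tate1950] §2.2, §2.5 · [Casselman1980] §3, Thm. 3.1 · [CasselmanShalika1980] Thm. 5.4 · [Langlands1971] §3.
-/

set_option autoImplicit false
-- the mandated namespace repeats the single-problem summit's segment (`HodgeConjecture.HodgeConjecture`)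
set_option linter.dupNamespace false

noncomputable section

open MeasureTheory Filter Topology Set TopologicalSpace
open scoped NNReal ENNReal
open Literature.NumberTheory.GaloisRepresentations Literature.NumberTheory.GaloisRepresentations.IsNonarchimedeanLocalField
open Literature.NumberTheory.Automorphic Literature.NumberTheory.Automorphic.LocalFieldHaar
open Summit.HodgeConjecture.HodgeConjecture.Cruxes.HLiu418.K2LiuGKRankOneIntegral
open Summit.HodgeConjecture.HodgeConjecture.Cruxes.H413.K2E1IntertwiningLocalFactorU2 (integrable_max_one_normAbs_rpow_neg integral_max_one_normAbs_rpow_neg)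
open Summit.HodgeConjecture.HodgeConjecture.Cruxes.H413.K2E1GindikinKarpelevichSplitGL3
open Summit.HodgeConjecture.HodgeConjecture.Cruxes.H413.K2E1GindikinKarpelevichSplitGL3Haar

namespace Summit.HodgeConjecture.HodgeConjecture.Cruxes.H413.K2E1FiniteWhittakerSplitU3Inner

variable {F : Type*} [Field F] [ValuativeRel F] [TopologicalSpace F] [IsNonarchimedeanLocalField F]
variable [MeasurableSpace F] [BorelSpace F] (μ : Measure F) [μ.IsAddHaarMeasure]

/-! ## §1  A radial function against an additive character: the shell formula -/

omit [MeasurableSpace F] [BorelSpace F] in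
/-- The outer sphere `𝔭^{-(k+1)} ∖ 𝔭^{-k}` (`‖a‖ = q^{k+1}`) is non-empty. [folklore] -/
theorem exists_mem_outerShell (k : ℕ) :
    ∃ a : F, a ∈ primePowBall F (-((k : ℤ) + 1)) \ primePowBall F (-((k : ℤ) + 1) + 1) := by
  obtain ⟨a, -, ha⟩ := exists_normAbs_eq_inv_zpow_of_int (F := F) (-((k : ℤ) + 1))
  exact ⟨a, mem_shell_iff.2 ha⟩

omit [MeasurableSpace F] [BorelSpace F] in
/-- A radial function is constant on each outer sphere. [folklore] -/
theorem radial_eq_on_outerShell {φ : F → ℂ} (hφ : ∀ y y' : F, normAbs F y = normAbs F y' → φ y = φ y') {k : ℕ} {a y : F}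
    (ha : a ∈ primePowBall F (-((k : ℤ) + 1)) \ primePowBall F (-((k : ℤ) + 1) + 1))
    (hy : y ∈ primePowBall F (-((k : ℤ) + 1)) \ primePowBall F (-((k : ℤ) + 1) + 1)) : φ y = φ a :=
  hφ y a ((mem_shell_iff.1 hy).trans (mem_shell_iff.1 ha).symm)

omit [μ.IsAddHaarMeasure] in
/-- The integral of a radial function over an outer sphere is its value times the measure of the sphere. [folklore] -/
theorem setIntegral_outerShell_radial {φ : F → ℂ} (hφ : ∀ y y' : F, normAbs F y = normAbs F y' → φ y = φ y') {k : ℕ} {a : F}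
    (ha : a ∈ primePowBall F (-((k : ℤ) + 1)) \ primePowBall F (-((k : ℤ) + 1) + 1)) :
    ∫ y in primePowBall F (-((k : ℤ) + 1)) \ primePowBall F (-((k : ℤ) + 1) + 1), φ y ∂μ =
      (μ.real (primePowBall F (-((k : ℤ) + 1)) \ primePowBall F (-((k : ℤ) + 1) + 1)) : ℂ) * φ a := by
  rw [setIntegral_congr_fun (measurableSet_shell _) (fun y hy => radial_eq_on_outerShell hφ ha hy), setIntegral_const, Complex.real_smul]

omit [μ.IsAddHaarMeasure] in
/-- `∫_{𝔭^{-n}} φ = ∫_𝒪 φ + Σ_{k<n} ∫_{𝔭^{-(k+1)} ∖ 𝔭^{-k}} φ` for `φ` integrable. [folklore] -/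
theorem setIntegral_primePowBall_neg_eq_add_sum {φ : F → ℂ} (hφi : Integrable φ μ) (n : ℕ) :
    ∫ y in primePowBall F (-(n : ℤ)), φ y ∂μ =
      (∫ y in primePowBall F 0, φ y ∂μ) +
        ∑ k ∈ Finset.range n, ∫ y in primePowBall F (-((k : ℤ) + 1)) \ primePowBall F (-((k : ℤ) + 1) + 1), φ y ∂μ := by
  induction n with
  | zero => rw [Finset.sum_range_zero, add_zero, Nat.cast_zero, neg_zero]
  | succ n ih =>
    have hidx : (-((n : ℤ) + 1) + 1) = -(n : ℤ) := by ring
    have hsub : primePowBall F (-((n : ℤ) + 1) + 1) ⊆ primePowBall F (-((n : ℤ) + 1)) := primePowBall_antitone (by omega)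
    rw [Nat.cast_succ, Finset.sum_range_succ, ← add_assoc, ← ih, setIntegral_sdiff (measurableSet_primePowBall _) hφi.integrableOn hsub, hidx]
    ring

/-- **THE SHELL FORMULA.**  Let `φ : F → ℂ` be integrable and RADIAL (`φ y` depends only on `‖y‖`), `ψ` a continuous additive character of conductor exponent `m`, and
`ξ ∈ 𝔭^{m+n} ∖ 𝔭^{m+n+1}` (`n = ord ξ − m ≥ 0`).  Then
`∫_F φ(y) ψ(yξ) dμ(y) = ∫_{𝔭^{-n}} φ dμ − (q − 1)⁻¹ · ∫_{𝔭^{-(n+1)} ∖ 𝔭^{-n}} φ dμ`: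
the character is `1` on `𝔭^{-n}`, integrates to `−μ(𝔭^{-n}) = −(q−1)⁻¹ μ(𝔭^{-(n+1)} ∖ 𝔭^{-n})` on the next sphere and to `0` on every sphere beyond (Tate's orthogonality
★ `setIntegral_primePowBall_addChar_mul` sphere by sphere). [cite: Tate1950, §2.5] [cite: Casselman1980, §3] -/
theorem integral_radial_mul_addChar_eq {φ : F → ℂ} (hφi : Integrable φ μ) (hφ : ∀ y y' : F, normAbs F y = normAbs F y' → φ y = φ y')
    {ψ : AddChar F Circle} (hψ : Continuous ψ) {m : ℤ} (hm : ψ.HasConductorExp m)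
    {ξ : F} {n : ℕ} (hn : ξ ∈ primePowBall F (m + n)) (hn' : ξ ∉ primePowBall F (m + n + 1)) :
    ∫ y, φ y * ((ψ (y * ξ) : Circle) : ℂ) ∂μ =
      (∫ y in primePowBall F (-(n : ℤ)), φ y ∂μ) -
        ((residueFieldCard F : ℂ) - 1)⁻¹ * ∫ y in primePowBall F (-((n : ℤ) + 1)) \ primePowBall F (-((n : ℤ) + 1) + 1), φ y ∂μ := by
  classical
  haveI : T2Space F := (isLocalField F).toT2Space
  set S : ℕ → Set F := fun k => primePowBall F (-((k : ℤ) + 1)) \ primePowBall F (-((k : ℤ) + 1) + 1) with hS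
  have hq : (residueFieldCard F : ℂ) ≠ 0 := Nat.cast_ne_zero.2 (residueFieldCard_ne_zero F)
  have hq1 : (residueFieldCard F : ℂ) - 1 ≠ 0 := by
    rw [sub_ne_zero]; exact_mod_cast (one_lt_residueFieldCard F).ne'
  -- the integrand
  have hg : Integrable (fun y => φ y * ((ψ (y * ξ) : Circle) : ℂ)) μ :=
    hφi.mul_bdd (continuous_subtype_val.comp (hψ.comp (continuous_id.mul continuous_const))).aestronglyMeasurable
      (Eventually.of_forall fun _ => (Circle.norm_coe _).le)
  have hψi : ∀ j : ℤ, IntegrableOn (fun t : F => ((ψ (t * ξ) : Circle) : ℂ)) (primePowBall F j) μ := fun j =>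
    (continuous_subtype_val.comp (hψ.comp (continuous_id.mul continuous_const))).continuousOn.integrableOn_compact (isCompact_primePowBall j)
  -- (1) on `𝒪` the character is trivial
  have h0 : ∫ y in primePowBall F 0, φ y * ((ψ (y * ξ) : Circle) : ℂ) ∂μ = ∫ y in primePowBall F 0, φ y ∂μ := by
    refine setIntegral_congr_fun (measurableSet_primePowBall 0) fun y hy => ?_
    have h : y * ξ ∈ primePowBall F m := primePowBall_antitone (show m ≤ 0 + (m + (n : ℤ)) by omega) (mul_mem_primePowBall hy hn)
    rw [hm.1 _ h, Circle.coe_one, mul_one]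
  -- (2) the character integrals on the spheres
  have hJ : ∀ j : ℤ, ∫ y in primePowBall F j, ((ψ (y * ξ) : Circle) : ℂ) ∂μ = if ξ ∈ primePowBall F (m - j) then (μ.real (primePowBall F j) : ℂ) else 0 :=
    fun j => setIntegral_primePowBall_addChar_mul μ hm j ξ
  have hmemA : ∀ k : ℕ, (ξ ∈ primePowBall F (m - -((k : ℤ) + 1))) ↔ k < n := by
    intro k
    rw [show m - -((k : ℤ) + 1) = m + ((k : ℤ) + 1) by ring]
    constructor
    · intro h
      by_contra hk
      exact hn' (primePowBall_antitone (show m + (n : ℤ) + 1 ≤ m + ((k : ℤ) + 1) by omega) h)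
    · intro hk
      exact primePowBall_antitone (show m + ((k : ℤ) + 1) ≤ m + (n : ℤ) by omega) hn
  have hmemB : ∀ k : ℕ, (ξ ∈ primePowBall F (m - (-((k : ℤ) + 1) + 1))) ↔ k ≤ n := by
    intro k
    rw [show m - (-((k : ℤ) + 1) + 1) = m + (k : ℤ) by ring]
    constructor
    · intro h
      by_contra hk
      exact hn' (primePowBall_antitone (show m + (n : ℤ) + 1 ≤ m + (k : ℤ) by omega) h)
    · intro hk
      exact primePowBall_antitone (show m + (k : ℤ) ≤ m + (n : ℤ) by omega) hn
  have hshell : ∀ k : ℕ, ∫ y in S k, φ y * ((ψ (y * ξ) : Circle) : ℂ) ∂μ =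
      if k < n then ∫ y in S k, φ y ∂μ else if k = n then -((μ.real (primePowBall F (-(n : ℤ))) : ℂ) * (μ.real (S n) : ℂ)⁻¹ * ∫ y in S n, φ y ∂μ) else 0 := by
    intro k
    obtain ⟨a, ha⟩ := exists_mem_outerShell (F := F) k
    have hsub : primePowBall F (-((k : ℤ) + 1) + 1) ⊆ primePowBall F (-((k : ℤ) + 1)) := primePowBall_antitone (by omega)
    have h1 : ∫ y in S k, φ y * ((ψ (y * ξ) : Circle) : ℂ) ∂μ = φ a * ((∫ y in primePowBall F (-((k : ℤ) + 1)), ((ψ (y * ξ) : Circle) : ℂ) ∂μ) -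
        ∫ y in primePowBall F (-((k : ℤ) + 1) + 1), ((ψ (y * ξ) : Circle) : ℂ) ∂μ) := by
      rw [setIntegral_congr_fun (measurableSet_shell _) (fun y hy => by rw [radial_eq_on_outerShell hφ ha hy]), integral_const_mul,
        setIntegral_sdiff (measurableSet_primePowBall _) (hψi _) hsub]
    have hSk : ∫ y in S k, φ y ∂μ = (μ.real (S k) : ℂ) * φ a := setIntegral_outerShell_radial μ hφ ha
    rw [h1, hJ, hJ]
    by_cases hk : k < n
    · rw [if_pos ((hmemA k).2 hk), if_pos ((hmemB k).2 hk.le), if_pos hk, hSk, hS]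
      simp only
      rw [measureReal_sdiff hsub (measurableSet_primePowBall _) (measure_primePowBall_lt_top μ _).ne]
      push_cast; ring
    · rw [if_neg (fun h => hk ((hmemA k).1 h)), if_neg hk]
      by_cases hkn : k = n
      · subst hkn
        rw [if_pos ((hmemB k).2 le_rfl), if_pos rfl, hSk, show (-((k : ℤ) + 1) + 1) = -(k : ℤ) by ring]
        have hSpos : (μ.real (S k) : ℂ) ≠ 0 := by
          rw [hS]; exact_mod_cast (by rw [measureReal_outerShell]; exact mul_pos (mul_pos (pow_pos (one_pos.trans one_lt_residueFieldCard_real) _)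
            (by rw [sub_pos]; exact inv_lt_one_of_one_lt₀ one_lt_residueFieldCard_real)) (measureReal_primePowBall_pos μ 0) :
            0 < μ.real (primePowBall F (-((k : ℤ) + 1)) \ primePowBall F (-((k : ℤ) + 1) + 1))).ne'
        field_simp
        ring
      · rw [if_neg (fun h => hkn (le_antisymm ((hmemB k).1 h) (not_lt.1 hk))), if_neg hkn, sub_zero, mul_zero]
  -- (3) assemble: `∫ = ∫_𝒪 + Σ' spheres`
  rw [← integral_add_compl (measurableSet_primePowBall 0) hg, h0, compl_primePowBall_zero_eq_iUnion,
    integral_iUnion (fun k => measurableSet_shell _) pairwise_disjoint_outerShell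
      (by rw [← compl_primePowBall_zero_eq_iUnion]; exact hg.integrableOn)]
  change (∫ y in primePowBall F 0, φ y ∂μ) + ∑' k, ∫ y in S k, φ y * ((ψ (y * ξ) : Circle) : ℂ) ∂μ = _
  simp_rw [hshell]
  rw [tsum_eq_sum (s := Finset.range (n + 1)) (fun k hk => by
      have hk' : n < k := by simpa [Finset.mem_range, Nat.lt_succ_iff, not_le] using hk
      rw [if_neg (by omega), if_neg (by omega)]),
    Finset.sum_range_succ, if_neg (lt_irrefl n), if_pos rfl,
    Finset.sum_congr rfl (fun k hk => by rw [if_pos (Finset.mem_range.1 hk)]),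
    setIntegral_primePowBall_neg_eq_add_sum μ hφi n]
  -- the constant: `μ(𝔭^{-n}) / μ(S n) = (q - 1)⁻¹`
  have hratio : ((μ.real (primePowBall F (-(n : ℤ)))) : ℂ) * (μ.real (S n) : ℂ)⁻¹ = ((residueFieldCard F : ℂ) - 1)⁻¹ := by
    rw [hS]
    simp only
    rw [measureReal_outerShell, measureReal_primePowBall μ (-(n : ℤ)), inv_zpow', neg_neg, zpow_natCast]
    have hμ0 : (μ.real (primePowBall F 0) : ℂ) ≠ 0 := by exact_mod_cast (measureReal_primePowBall_pos μ 0).ne'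
    push_cast
    field_simp
    ring
  rw [hratio]
  ring


/-! ## §2  The complex weights: continuity, norms, integrability, discreteness bookkeeping -/

omit [MeasurableSpace F] [BorelSpace F] in
/-- `x ↦ (f x)^{−s}` (complex power of a real function `≥ 1`) is continuous when `f` is. [folklore] -/
theorem continuous_ofReal_cpow_neg {X : Type*} [TopologicalSpace X] {f : X → ℝ} (hf : Continuous f) (h1 : ∀ x, 1 ≤ f x) (s : ℂ) :
    Continuous fun x => ((f x : ℝ) : ℂ) ^ (-s) :=
  (Complex.continuous_ofReal.comp hf).cpow continuous_const fun x => Complex.ofReal_mem_slitPlane.2 (lt_of_lt_of_le one_pos (h1 x))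

omit [MeasurableSpace F] [BorelSpace F] in
/-- `‖M^{−s}‖ = M^{−Re s}` for a real base `M ≥ 1`. [folklore] -/
theorem norm_ofReal_cpow_neg {M : ℝ} (hM : 1 ≤ M) (s : ℂ) : ‖((M : ℝ) : ℂ) ^ (-s)‖ = M ^ (-s.re) := by
  rw [Complex.norm_cpow_eq_rpow_re_of_pos (lt_of_lt_of_le one_pos hM), Complex.neg_re]

omit [MeasurableSpace F] [BorelSpace F] in
/-- The norm of the twisted `y`-integrand: `‖B(y,w)^{−s}·ψ(yξ)‖ = B(y,w)^{−Re s}`. [folklore] -/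
theorem norm_weight_mul_addChar (M : ℝ) (hM : 1 ≤ M) (s : ℂ) (c : Circle) : ‖((M : ℝ) : ℂ) ^ (-s) * ((c : Circle) : ℂ)‖ = M ^ (-s.re) := by
  rw [norm_mul, Circle.norm_coe, mul_one, norm_ofReal_cpow_neg hM]

omit [MeasurableSpace F] [BorelSpace F] in
/-- Discreteness: `‖z‖ ∉ (1, q)`, i.e. `z ∉ 𝒪 ⟹ q ≤ ‖z‖`. [folklore] -/
theorem residueFieldCard_le_coe_normAbs_of_not_mem {z : F} (hz : z ∉ primePowBall F 0) : (residueFieldCard F : ℝ) ≤ ((normAbs F z : ℝ≥0) : ℝ) := by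
  have h : ¬ normAbs F z < ((residueFieldCard F : ℝ≥0)⁻¹) ^ (-1 : ℤ) := fun h' =>
    hz (by rw [mem_primePowBall_iff, show (0 : ℤ) = -1 + 1 by norm_num]; exact normAbs_lt_zpow_iff.1 h')
  rw [not_lt, zpow_neg_one, inv_inv] at h
  exact_mod_cast h

omit [MeasurableSpace F] [BorelSpace F] in
/-- `z ∈ 𝒪 ⟺ ‖z‖ ≤ 1` in `ℝ`. [folklore] -/
theorem coe_normAbs_le_one_of_mem {z : F} (hz : z ∈ primePowBall F 0) : ((normAbs F z : ℝ≥0) : ℝ) ≤ 1 := by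
  rw [mem_primePowBall_iff, zpow_zero] at hz
  exact_mod_cast hz

/-- The floor weight `u ↦ max(1,‖w‖,‖u‖)^{−s}` is integrable for `Re s > 1` (dominated by `max(1,‖u‖)^{−Re s}` ★ p858040). [cite: Casselman1980, Thm. 3.1] -/
theorem integrable_floorWeight {s : ℂ} (hs : 1 < s.re) (w : F) :
    Integrable (fun u : F => ((max 1 (max ((normAbs F w : ℝ≥0) : ℝ) ((normAbs F u : ℝ≥0) : ℝ)) : ℝ) : ℂ) ^ (-s)) μ := by
  refine (integrable_max_one_normAbs_rpow_neg μ hs).mono' ?_ (Eventually.of_forall fun u => ?_)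
  · exact (continuous_ofReal_cpow_neg (continuous_const.max (continuous_const.max continuous_coe_normAbs)) (fun _ => le_max_left _ _) s).aestronglyMeasurable
  · rw [norm_ofReal_cpow_neg (le_max_left _ _)]
    exact Real.rpow_le_rpow_of_nonpos (lt_of_lt_of_le one_pos (le_max_left _ _)) (max_le_max le_rfl (le_max_right _ _)) (by linarith)

omit [MeasurableSpace F] [BorelSpace F] in
/-- The twisted floor integrand `(w,u) ↦ max(1,‖w‖,‖u‖)^{−s}·ψ(uη)` is continuous on `F × F`. [folklore] -/
theorem continuous_floorWeight_mul_addChar {ψ : AddChar F Circle} (hψ : Continuous ψ) (η : F) (s : ℂ) :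
    Continuous fun p : F × F => ((max 1 (max ((normAbs F p.1 : ℝ≥0) : ℝ) ((normAbs F p.2 : ℝ≥0) : ℝ)) : ℝ) : ℂ) ^ (-s) * ((ψ (p.2 * η) : Circle) : ℂ) :=
  (continuous_ofReal_cpow_neg (continuous_const.max ((continuous_coe_normAbs.comp continuous_fst).max (continuous_coe_normAbs.comp continuous_snd)))
    (fun _ => le_max_left _ _) s).mul (continuous_subtype_val.comp (hψ.comp (continuous_snd.mul continuous_const)))

/-- The floor integral `G_η(w) = ∫_u max(1,‖w‖,‖u‖)^{−s} ψ(uη) dμ(u)` is an a.e.-strongly measurable function of `w` (parametric integral of a continuous kernel). [folklore] -/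
theorem aestronglyMeasurable_floorIntegral {ψ : AddChar F Circle} (hψ : Continuous ψ) (η : F) (s : ℂ) :
    AEStronglyMeasurable (fun w : F => ∫ u, ((max 1 (max ((normAbs F w : ℝ≥0) : ℝ) ((normAbs F u : ℝ≥0) : ℝ)) : ℝ) : ℂ) ^ (-s) * ((ψ (u * η) : Circle) : ℂ) ∂μ) μ := by
  haveI : T2Space F := (isLocalField F).toT2Space
  haveI : SecondCountableTopology F := secondCountableTopology_localField F
  exact ((continuous_floorWeight_mul_addChar hψ η s).aestronglyMeasurable (μ := μ.prod μ)).integral_prod_right'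

/-- The trivial bound `‖G_η(w)‖ ≤ G(Re s) = ∫ max(1,‖u‖)^{−Re s} dμ` (`|ψ| = 1`, floor dropped). [folklore] -/
theorem norm_floorIntegral_le {ψ : AddChar F Circle} (η : F) {s : ℂ} (hs : 1 < s.re) (w : F) :
    ‖∫ u, ((max 1 (max ((normAbs F w : ℝ≥0) : ℝ) ((normAbs F u : ℝ≥0) : ℝ)) : ℝ) : ℂ) ^ (-s) * ((ψ (u * η) : Circle) : ℂ) ∂μ‖ ≤
      ∫ u, (max 1 ((normAbs F u : ℝ≥0) : ℝ)) ^ (-s.re) ∂μ := by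
  refine norm_integral_le_of_norm_le (integrable_max_one_normAbs_rpow_neg μ hs) (Eventually.of_forall fun u => ?_)
  rw [norm_weight_mul_addChar _ (le_max_left _ _)]
  exact Real.rpow_le_rpow_of_nonpos (lt_of_lt_of_le one_pos (le_max_left _ _)) (max_le_max le_rfl (le_max_right _ _)) (by linarith)

/-! ## §3  The floor integral against a character: unit frequency and frequency of level one -/

/-- **UNIT FREQUENCY.**  For `ψ` of conductor exponent `m`, `ξ ∈ 𝔭^m ∖ 𝔭^{m+1}` and `Re s > 1`:
`∫_u max(1,‖w‖,‖u‖)^{−s} ψ(uξ) dμ(u) = μ(𝒪)·( max(1,‖w‖)^{−s} − max(q,‖w‖)^{−s} )` for every `w` — the shell formula with `n = 0` (the weight is `max(1,‖w‖)^{−s}` on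
`𝒪` and `max(q,‖w‖)^{−s}` on the sphere `‖u‖ = q`).  [cite: Casselman1980, §3] [cite: Tate1950, §2.5] -/
theorem integral_floorWeight_mul_addChar_of_level_zero {ψ : AddChar F Circle} (hψ : Continuous ψ) {m : ℤ} (hm : ψ.HasConductorExp m)
    {ξ : F} (hξ : ξ ∈ primePowBall F m) (hξ' : ξ ∉ primePowBall F (m + 1)) {s : ℂ} (hs : 1 < s.re) (w : F) :
    ∫ u, ((max 1 (max ((normAbs F w : ℝ≥0) : ℝ) ((normAbs F u : ℝ≥0) : ℝ)) : ℝ) : ℂ) ^ (-s) * ((ψ (u * ξ) : Circle) : ℂ) ∂μ =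
      (μ.real (primePowBall F 0) : ℂ) *
        ((((max 1 ((normAbs F w : ℝ≥0) : ℝ)) : ℝ) : ℂ) ^ (-s) - (((max (residueFieldCard F : ℝ) ((normAbs F w : ℝ≥0) : ℝ)) : ℝ) : ℂ) ^ (-s)) := by
  have hq1 : (residueFieldCard F : ℂ) - 1 ≠ 0 := by
    rw [sub_ne_zero]; exact_mod_cast (one_lt_residueFieldCard F).ne'
  have hR := integral_radial_mul_addChar_eq μ (integrable_floorWeight μ hs w) (fun y y' h => by simp only [h]) hψ hm (n := 0)
    (by rwa [Nat.cast_zero, add_zero]) (by rwa [Nat.cast_zero, add_zero])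
  rw [hR]
  -- on `𝒪` the weight is `max(1,‖w‖)^{-s}`
  have h0 : ∫ u in primePowBall F (-((0 : ℕ) : ℤ)), ((max 1 (max ((normAbs F w : ℝ≥0) : ℝ) ((normAbs F u : ℝ≥0) : ℝ)) : ℝ) : ℂ) ^ (-s) ∂μ =
      (μ.real (primePowBall F 0) : ℂ) * (((max 1 ((normAbs F w : ℝ≥0) : ℝ)) : ℝ) : ℂ) ^ (-s) := by
    rw [show (-((0 : ℕ) : ℤ)) = 0 by simp, setIntegral_congr_fun (measurableSet_primePowBall 0) (fun u hu => by
      rw [show max 1 (max ((normAbs F w : ℝ≥0) : ℝ) ((normAbs F u : ℝ≥0) : ℝ)) = max 1 ((normAbs F w : ℝ≥0) : ℝ) by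
        rw [← max_assoc, max_eq_left ((le_max_left _ _).trans' (coe_normAbs_le_one_of_mem hu))]]), setIntegral_const, Complex.real_smul]
  -- on the sphere `‖u‖ = q` it is `max(q,‖w‖)^{-s}`
  have h1 : ∫ u in primePowBall F (-(((0 : ℕ) : ℤ) + 1)) \ primePowBall F (-(((0 : ℕ) : ℤ) + 1) + 1), ((max 1 (max ((normAbs F w : ℝ≥0) : ℝ) ((normAbs F u : ℝ≥0) : ℝ)) : ℝ) : ℂ) ^ (-s) ∂μ =
      (((residueFieldCard F : ℝ) - 1) * μ.real (primePowBall F 0) : ℝ) * (((max (residueFieldCard F : ℝ) ((normAbs F w : ℝ≥0) : ℝ)) : ℝ) : ℂ) ^ (-s) := by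
    rw [setIntegral_congr_fun (measurableSet_shell _) (fun u hu => by
      rw [show max 1 (max ((normAbs F w : ℝ≥0) : ℝ) ((normAbs F u : ℝ≥0) : ℝ)) = max (residueFieldCard F : ℝ) ((normAbs F w : ℝ≥0) : ℝ) by
        rw [coe_normAbs_of_mem_outerShell hu, zero_add, pow_one, max_comm (residueFieldCard F : ℝ), max_eq_right (le_max_of_le_right one_lt_residueFieldCard_real.le)]]),
      setIntegral_const, Complex.real_smul, measureReal_outerShell, zero_add, pow_one]
    have hq : (residueFieldCard F : ℂ) ≠ 0 := Nat.cast_ne_zero.2 (residueFieldCard_ne_zero F)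
    congr 1
    push_cast
    rw [mul_sub, mul_one, mul_inv_cancel₀ hq]
  rw [h0, h1]
  push_cast
  field_simp

/-- Unit frequency, `w ∈ 𝒪`: `∫_u max(1,‖w‖,‖u‖)^{−s} ψ(uξ) dμ = μ(𝒪)(1 − q^{−s})` — the Euler factor `ζ_F(s)⁻¹`. [cite: Casselman1980, §3] -/
theorem integral_floorWeight_mul_addChar_of_level_zero_of_mem {ψ : AddChar F Circle} (hψ : Continuous ψ) {m : ℤ} (hm : ψ.HasConductorExp m)
    {ξ : F} (hξ : ξ ∈ primePowBall F m) (hξ' : ξ ∉ primePowBall F (m + 1)) {s : ℂ} (hs : 1 < s.re) {w : F} (hw : w ∈ primePowBall F 0) :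
    ∫ u, ((max 1 (max ((normAbs F w : ℝ≥0) : ℝ) ((normAbs F u : ℝ≥0) : ℝ)) : ℝ) : ℂ) ^ (-s) * ((ψ (u * ξ) : Circle) : ℂ) ∂μ =
      (μ.real (primePowBall F 0) : ℂ) * (1 - (residueFieldCard F : ℂ) ^ (-s)) := by
  rw [integral_floorWeight_mul_addChar_of_level_zero μ hψ hm hξ hξ' hs w, max_eq_left (coe_normAbs_le_one_of_mem hw),
    max_eq_left ((coe_normAbs_le_one_of_mem hw).trans one_lt_residueFieldCard_real.le), Complex.ofReal_one, Complex.one_cpow, Complex.ofReal_natCast]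

/-- Unit frequency, `w ∉ 𝒪`: `∫_u max(1,‖w‖,‖u‖)^{−s} ψ(uξ) dμ = 0` (both maxima equal `‖w‖ ≥ q`). [cite: Casselman1980, §3] -/
theorem integral_floorWeight_mul_addChar_of_level_zero_of_not_mem {ψ : AddChar F Circle} (hψ : Continuous ψ) {m : ℤ} (hm : ψ.HasConductorExp m)
    {ξ : F} (hξ : ξ ∈ primePowBall F m) (hξ' : ξ ∉ primePowBall F (m + 1)) {s : ℂ} (hs : 1 < s.re) {w : F} (hw : w ∉ primePowBall F 0) :
    ∫ u, ((max 1 (max ((normAbs F w : ℝ≥0) : ℝ) ((normAbs F u : ℝ≥0) : ℝ)) : ℝ) : ℂ) ^ (-s) * ((ψ (u * ξ) : Circle) : ℂ) ∂μ = 0 := by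
  have h := residueFieldCard_le_coe_normAbs_of_not_mem hw
  rw [integral_floorWeight_mul_addChar_of_level_zero μ hψ hm hξ hξ' hs w, max_eq_right (one_lt_residueFieldCard_real.le.trans h), max_eq_right h, sub_self, mul_zero]

/-- **FREQUENCY OF LEVEL ONE.**  For `ψ` of conductor exponent `m`, `η ∈ 𝔭^{m+1} ∖ 𝔭^{m+2}`, `Re s > 1` and a floor `‖w‖ ≤ q` (`w ∈ 𝔭^{-1}`):
`∫_u max(1,‖w‖,‖u‖)^{−s} ψ(uη) dμ(u) = μ(𝒪)·( max(1,‖w‖)^{−s} + (q − 1)·q^{−s} − q·(q^{−s})² )` — the shell formula with `n = 1` (weight `max(1,‖w‖)^{−s}` on `𝒪`, `q^{−s}`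
on the sphere `‖u‖ = q`, `q^{−2s}` on the sphere `‖u‖ = q²`).  [cite: Casselman1980, §3] [cite: Tate1950, §2.5] -/
theorem integral_floorWeight_mul_addChar_of_level_one {ψ : AddChar F Circle} (hψ : Continuous ψ) {m : ℤ} (hm : ψ.HasConductorExp m)
    {η : F} (hη : η ∈ primePowBall F (m + 1)) (hη' : η ∉ primePowBall F (m + 1 + 1)) {s : ℂ} (hs : 1 < s.re) {w : F} (hw : w ∈ primePowBall F (-1)) :
    ∫ u, ((max 1 (max ((normAbs F w : ℝ≥0) : ℝ) ((normAbs F u : ℝ≥0) : ℝ)) : ℝ) : ℂ) ^ (-s) * ((ψ (u * η) : Circle) : ℂ) ∂μ =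
      (μ.real (primePowBall F 0) : ℂ) *
        ((((max 1 ((normAbs F w : ℝ≥0) : ℝ)) : ℝ) : ℂ) ^ (-s) + ((residueFieldCard F : ℂ) - 1) * (residueFieldCard F : ℂ) ^ (-s) -
          (residueFieldCard F : ℂ) * ((residueFieldCard F : ℂ) ^ (-s)) ^ 2) := by
  have hq1 : (residueFieldCard F : ℂ) - 1 ≠ 0 := by
    rw [sub_ne_zero]; exact_mod_cast (one_lt_residueFieldCard F).ne'
  have hwq : ((normAbs F w : ℝ≥0) : ℝ) ≤ residueFieldCard F := by
    rw [mem_primePowBall_iff, zpow_neg_one, inv_inv] at hw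
    exact_mod_cast hw
  have hR := integral_radial_mul_addChar_eq μ (integrable_floorWeight μ hs w) (fun y y' h => by simp only [h]) hψ hm (n := 1)
    (by rwa [Nat.cast_one]) (by rwa [Nat.cast_one])
  rw [hR, setIntegral_primePowBall_neg_eq_add_sum μ (integrable_floorWeight μ hs w) 1, Finset.sum_range_one]
  -- on `𝒪`
  have h0 : ∫ u in primePowBall F 0, ((max 1 (max ((normAbs F w : ℝ≥0) : ℝ) ((normAbs F u : ℝ≥0) : ℝ)) : ℝ) : ℂ) ^ (-s) ∂μ =
      (μ.real (primePowBall F 0) : ℂ) * (((max 1 ((normAbs F w : ℝ≥0) : ℝ)) : ℝ) : ℂ) ^ (-s) := by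
    rw [setIntegral_congr_fun (measurableSet_primePowBall 0) (fun u hu => by
      rw [show max 1 (max ((normAbs F w : ℝ≥0) : ℝ) ((normAbs F u : ℝ≥0) : ℝ)) = max 1 ((normAbs F w : ℝ≥0) : ℝ) by
        rw [← max_assoc, max_eq_left ((le_max_left _ _).trans' (coe_normAbs_le_one_of_mem hu))]]), setIntegral_const, Complex.real_smul]
  -- on the spheres `‖u‖ = q^{k+1}`, `k = 0, 1`, the weight is `(q^{-s})^{k+1}`
  have hS : ∀ k : ℕ, k ≤ 1 → ∫ u in primePowBall F (-((k : ℤ) + 1)) \ primePowBall F (-((k : ℤ) + 1) + 1), ((max 1 (max ((normAbs F w : ℝ≥0) : ℝ) ((normAbs F u : ℝ≥0) : ℝ)) : ℝ) : ℂ) ^ (-s) ∂μ =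
      (((residueFieldCard F : ℝ) ^ (k + 1) * (1 - (residueFieldCard F : ℝ)⁻¹) * μ.real (primePowBall F 0) : ℝ) : ℂ) * ((residueFieldCard F : ℂ) ^ (-s)) ^ (k + 1) := by
    intro k hk
    have hqk : ((normAbs F w : ℝ≥0) : ℝ) ≤ (residueFieldCard F : ℝ) ^ (k + 1) :=
      hwq.trans (by simpa using pow_le_pow_right₀ one_lt_residueFieldCard_real.le (Nat.succ_le_succ (Nat.zero_le k)))
    rw [setIntegral_congr_fun (measurableSet_shell _) (fun u hu => by
      rw [show max 1 (max ((normAbs F w : ℝ≥0) : ℝ) ((normAbs F u : ℝ≥0) : ℝ)) = (residueFieldCard F : ℝ) ^ (k + 1) by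
        rw [coe_normAbs_of_mem_outerShell hu, max_eq_right hqk, max_eq_right (one_le_pow₀ one_lt_residueFieldCard_real.le)], ofReal_pow_cpow]),
      setIntegral_const, Complex.real_smul, measureReal_outerShell]
  rw [h0, hS 0 zero_le_one, hS 1 le_rfl]
  have hq : (residueFieldCard F : ℂ) ≠ 0 := Nat.cast_ne_zero.2 (residueFieldCard_ne_zero F)
  push_cast
  field_simp

end Summit.HodgeConjecture.HodgeConjecture.Cruxes.H413.K2E1FiniteWhittakerSplitU3Inner

end
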